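import Summits.FinalStateConjecture.FinalStateConjecture.Theorems.EIHFluxBalanceInertialRecessionStubEndgameBasics

/-!
# Route EIHFluxBalance — crux `InertialRecession`, abstract endgame for general `N`:
# Abel summation with fuzz (how the rate-free identification error `ζ` is paid once per window path)

Helper file for the crux `stmt-FinalStateConjecture-10166` (virial route, evidence note
`InertialRecession_endgame_generalN_virial.md`, §5.3). Along an admissible window path the kinematic cluster momentum is a SHARP
function plus a fuzz `f(n)` with `‖f(n) − f(0)‖ ≤ ζ` (identification at the two ends of each sub-path); in the virial sum the
increments of `f` are paired with LEVERS `ℓ(n)` (centre differences, moving at bounded speed). Abel summation moves the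
difference onto the levers, so the total fuzz cost is `ζ·(‖last lever‖ + total variation of the levers)` — independent of the
number of steps. Mathlib-only.

* `sum_inner_sub_eq_abel` — `Σ_{n<m} ⟨f(n+1) − f(n), ℓ(n+1)⟩ = ⟨f(m) − f(0), ℓ(m)⟩ − Σ_{n<m} ⟨f(n) − f(0), ℓ(n+1) − ℓ(n)⟩`.
* `abs_sum_inner_sub_le_fuzz` — if `‖f(n) − f(0)‖ ≤ ζ` for `n ≤ m` then
  `|Σ_{n<m} ⟨f(n+1) − f(n), ℓ(n+1)⟩| ≤ ζ (‖ℓ(m)‖ + Σ_{n<m} ‖ℓ(n+1) − ℓ(n)‖)`.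
-/

noncomputable section

set_option linter.dupNamespace false

open Finset

namespace Summit.FinalStateConjecture.FinalStateConjecture.Theorems.SublinearIsFree.Virial

open Literature.Geometry.Lorentzian

/-- **Abel summation (increments paired with levers).** For `f ℓ : ℕ → E3`:
`Σ_{n<m} ⟨f(n+1) − f(n), ℓ(n+1)⟩ = ⟨f(m) − f(0), ℓ(m)⟩ − Σ_{n<m} ⟨f(n) − f(0), ℓ(n+1) − ℓ(n)⟩`. [folklore] -/
theorem sum_inner_sub_eq_abel (f ℓ : ℕ → E3) (m : ℕ) :
    ∑ n ∈ range m, inner ℝ (f (n + 1) - f n) (ℓ (n + 1)) =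
      inner ℝ (f m - f 0) (ℓ m) - ∑ n ∈ range m, inner ℝ (f n - f 0) (ℓ (n + 1) - ℓ n) := by
  induction m with
  | zero => simp
  | succ m ih =>
    rw [Finset.sum_range_succ, Finset.sum_range_succ, ih]
    have h1 : inner ℝ (f (m + 1) - f m) (ℓ (m + 1)) =
        inner ℝ (f (m + 1) - f 0) (ℓ (m + 1)) - inner ℝ (f m - f 0) (ℓ (m + 1)) := by
      rw [← inner_sub_left]; congr 1; abel
    have h2 : inner ℝ (f m - f 0) (ℓ (m + 1) - ℓ m) =
        inner ℝ (f m - f 0) (ℓ (m + 1)) - inner ℝ (f m - f 0) (ℓ m) := inner_sub_right _ _ _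
    rw [h1, h2]
    ring

/-- **Fuzz bound.** If `‖f(n) − f(0)‖ ≤ ζ` for all `n ≤ m` then
`|Σ_{n<m} ⟨f(n+1) − f(n), ℓ(n+1)⟩| ≤ ζ (‖ℓ(m)‖ + Σ_{n<m} ‖ℓ(n+1) − ℓ(n)‖)`: the cost of a fuzz of size `ζ` paired with levers is
`ζ ×` (last lever + total variation of the levers), whatever the number of steps. [folklore] -/
theorem abs_sum_inner_sub_le_fuzz' (f ℓ : ℕ → E3) (m : ℕ) (ζ : ℝ) (hf : ∀ n, n ≤ m → ‖f n - f 0‖ ≤ ζ) :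
    |∑ n ∈ range m, inner ℝ (f (n + 1) - f n) (ℓ (n + 1))| ≤
      ζ * (‖ℓ m‖ + ∑ n ∈ range m, ‖ℓ (n + 1) - ℓ n‖) := by
  rw [sum_inner_sub_eq_abel]
  have hζ : 0 ≤ ζ := (norm_nonneg _).trans (hf 0 (Nat.zero_le _))
  have h1 : |inner ℝ (f m - f 0) (ℓ m)| ≤ ζ * ‖ℓ m‖ :=
    (abs_real_inner_le_norm _ _).trans (mul_le_mul_of_nonneg_right (hf m le_rfl) (norm_nonneg _))
  have h2 : |∑ n ∈ range m, inner ℝ (f n - f 0) (ℓ (n + 1) - ℓ n)| ≤ ζ * ∑ n ∈ range m, ‖ℓ (n + 1) - ℓ n‖ := by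
    rw [Finset.mul_sum]
    refine (Finset.abs_sum_le_sum_abs _ _).trans (Finset.sum_le_sum fun n hn ↦ ?_)
    have hnm : n ≤ m := (Finset.mem_range.mp hn).le
    exact (abs_real_inner_le_norm _ _).trans (mul_le_mul_of_nonneg_right (hf n hnm) (norm_nonneg _))
  calc |inner ℝ (f m - f 0) (ℓ m) - ∑ n ∈ range m, inner ℝ (f n - f 0) (ℓ (n + 1) - ℓ n)|
      ≤ |inner ℝ (f m - f 0) (ℓ m)| + |∑ n ∈ range m, inner ℝ (f n - f 0) (ℓ (n + 1) - ℓ n)| := abs_sub _ _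
    _ ≤ ζ * ‖ℓ m‖ + ζ * ∑ n ∈ range m, ‖ℓ (n + 1) - ℓ n‖ := add_le_add h1 h2
    _ = ζ * (‖ℓ m‖ + ∑ n ∈ range m, ‖ℓ (n + 1) - ℓ n‖) := by ring

/-- Registered stub `abs_sum_inner_sub_le_fuzz` (crux `stmt-FinalStateConjecture-10166`): the Abel-summation fuzz bound, one-line
form of `abs_sum_inner_sub_le_fuzz'`. [folklore] -/
theorem abs_sum_inner_sub_le_fuzz : open Literature.Geometry.Lorentzian Finset in ∀ (f ℓ : ℕ → E3) (m : ℕ) (ζ : ℝ), (∀ n, n ≤ m → ‖f n - f 0‖ ≤ ζ) → |∑ n ∈ range m, inner ℝ (f (n + 1) - f n) (ℓ (n + 1))| ≤ ζ * (‖ℓ m‖ + ∑ n ∈ range m, ‖ℓ (n + 1) - ℓ n‖) :=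
  fun f ℓ m ζ hf ↦ abs_sum_inner_sub_le_fuzz' f ℓ m ζ hf

end Summit.FinalStateConjecture.FinalStateConjecture.Theorems.SublinearIsFree.Virial

end
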